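import Summits.AtomisticToContinuum.Crystallization.Theses.BrittleRungDescent
import Summits.AtomisticToContinuum.Crystallization.Theorems.BrittleRungDescentLadderGroundStatesExistence
import Summits.AtomisticToContinuum.Crystallization.Theorems.BrittleRungDescentLadderGroundStatesSeparation
import HarnessLib

/-!
# Route `BrittleRungDescent`, support item `LadderGroundStates` (stmt-AtomisticToContinuum-10945):
# the closing theorem

`LadderGroundStates` asks for a threshold `q₀` such that for every rung `q ≥ q₀` of the Mie
`(2q, q)` ladder (`V_q = miePotential q`, `V_q(r) = r^{-2q}/(2q) - r^{-q}/q`) in `ℝ³`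

* ground states exist for every particle number `N`, and
* every ground state is `(1 - 2/q)`-separated.

Both halves are already in the tree as helpers of this item:
`LadderGroundStates.exists_isGroundState_miePotential` (existence for every `q ≥ 1`, Blanc–Lewin
2015 §1.2 binding + compactness, files `…LadderGroundStatesBinding.lean`,
`…LadderGroundStatesExistence.lean`) and
`LadderGroundStates.le_dist_of_isGroundState_miePotential` (separation for `q ≥ 500`,
removal-plus-packing as in `LennardJonesMinimalDistance_holds`, file
`…LadderGroundStatesSeparation.lean`). This file assembles them with `q₀ = 500`.
-/

namespace Summit.AtomisticToContinuum.Crystallization.Theorems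

open Literature.MathematicalPhysics.StatisticalMechanics

/-- **Ground states on the `(2q,q)` ladder exist and are `(1 - 2/q)`-separated for `q ≥ 500`**:
the route decl `LadderGroundStates` of `BrittleRungDescent` (item stmt-AtomisticToContinuum-10945),
with witness `q₀ = 500`; existence from `LadderGroundStates.exists_isGroundState_miePotential`
(valid for all `q ≥ 1`) and separation from
`LadderGroundStates.le_dist_of_isGroundState_miePotential`. [cite: BlancLewin2015, §1.2 and §2.2] -/
theorem LadderGroundStates_proof :
    Summit.AtomisticToContinuum.Crystallization.Theses.BrittleRungDescent.LadderGroundStates := by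
  unfold Summit.AtomisticToContinuum.Crystallization.Theses.BrittleRungDescent.LadderGroundStates
  refine ⟨500, fun q hq => ⟨fun N => ?_, fun N x hx i j hij => ?_⟩⟩
  · exact LadderGroundStates.exists_isGroundState_miePotential (by omega) N
  · exact LadderGroundStates.le_dist_of_isGroundState_miePotential hq hx hij

end Summit.AtomisticToContinuum.Crystallization.Theorems
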